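import Summits.QuantumFields.YangMills.Theorems.UnitScaleTiltFluctuationComparisonRegPrFibreDifferential
import Mathlib.Analysis.Calculus.InverseFunctionTheorem.ApproximatesLinearOn
import Mathlib.Analysis.Calculus.MeanValue

/-!
# Route `UnitScaleTilt` — crux K1bR-pr `FluctuationComparisonRegPr` (stmt-QuantumFields-19201), stub `stub_oneStepSmallLift`
# (W7 line), step 1b: A UNIFORM LOCAL INVERSE OF THE EXP-MEAN-LOG FIBRE MAP NEAR ITS DEGENERATE SET
# (support file `--supports stmt-QuantumFields-19201`; quaternion calculus + Mathlib's inverse function theorem)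

Cell `ym3-torus` (rung R3), seat `ym3-torus-p2` gen 8.  With the model differential `D₀` and the joint continuity of `kD` from
`…FibreDifferential`, Mathlib's `ApproximatesLinearOn` machinery gives, UNIFORMLY in the parameters `a` (the frozen open
holonomies) near the degenerate set `a_i = u⋆`:

* `exists_approximatesLinearOn` / `exists_kf_eq_near_one` (§4): `ρ > 0` with: for `‖a_i − 1‖ ≤ ρ`, `‖u⋆ − 1‖ ≤ ρ` and every
  target `t` within `(1 − s)ρ/2` of `kf a c u⋆` there is `u` with `kf a c u = t` and `‖u − u⋆‖ ≤ (2/(1 − s))·‖t − kf a c u⋆‖`;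
* `exists_kf_eq_near` (§5): the same around ANY unit base point `u⋆` with `‖a_i − u⋆‖ ≤ ρ`, the solution lying in the guard
  (right translation `u ↦ u q̄` is an isometry intertwining the fibre maps, `kf_mul_star`);
* `norm_eq_one_of_kf_eq` (§6): a solution with a unit target is a unit (`‖kf a c y‖ = ‖y‖^{1+s}`, `norm_kf`).

Consumer: the middle-bond repair lemma («exactness is free» for the one-step small lift).  Every declaration is elementary
calculus on `ℍ` ([folklore]); nothing of Bałaban's is asserted.
-/

noncomputable section

open NormedSpace Set Metric Function Filter Topology
open scoped RealInnerProductSpace Quaternion NNReal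

namespace Summit.QuantumFields.YangMills.Theorems.FibreLocalInverse

open Literature.MathematicalPhysics.QuantumFieldTheory.Balaban1983to89.T4EMLFibreAC
open Literature.MathematicalPhysics.QuantumFieldTheory.Balaban1983to89.T4QuatExpLog

/-! ## §4 The inverse function theorem near the degenerate point, uniformly in the parameters -/

section IFT

variable {ι : Type*} [Fintype ι]

/-- Distance to the degenerate point in the product: `‖a_i − 1‖ ≤ r` and `‖y − 1‖ ≤ r` give `dist (a, y) (1, 1) ≤ r`. -/
theorem dist_le_of_coords {a : ι → ℍ} {y : ℍ} {r : ℝ} (hr : 0 ≤ r) (ha : ∀ i, ‖a i - 1‖ ≤ r) (hy : ‖y - 1‖ ≤ r) :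
    dist ((a, y) : (ι → ℍ) × ℍ) ((fun _ : ι => (1 : ℍ)), (1 : ℍ)) ≤ r := by
  rw [Prod.dist_eq, max_le_iff]
  refine ⟨?_, by rwa [dist_eq_norm]⟩
  rw [dist_pi_le_iff hr]
  intro i
  rw [dist_eq_norm]
  exact ha i

/-- **UNIFORM LINEAR APPROXIMATION NEAR THE DEGENERATE POINT.**  For weights with `s = Σ c_i < 1` there is `ρ > 0` such that for
all parameters `a` with `‖a_i − 1‖ ≤ 2ρ`: every `y` with `‖y − 1‖ ≤ 2ρ` lies in the guard, and on the ball `‖y − 1‖ ≤ 2ρ` the fibre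
map `kf a c` is approximated by the model differential `D₀` up to the Lipschitz constant `(1 − s)/2`. -/
theorem exists_approximatesLinearOn (c : ι → ℝ) (hs : ∑ i, c i < 1) :
    ∃ ρ : ℝ, 0 < ρ ∧ ∀ a : ι → ℍ, (∀ i, ‖a i - 1‖ ≤ 2 * ρ) →
      (∀ y : ℍ, ‖y - 1‖ ≤ 2 * ρ → ∀ i, ‖a i * star y - 1‖ < 1) ∧
      ApproximatesLinearOn (kf a c) (dZero (∑ i, c i)) (closedBall (1 : ℍ) (2 * ρ)) ((1 - ∑ i, c i) / 2).toNNReal := by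
  set s : ℝ := ∑ i, c i with hs_def
  have hε : 0 < (1 - s) / 2 := by linarith
  -- continuity of the differential at the degenerate point, inside the open guard region
  set p₀ : (ι → ℍ) × ℍ := ((fun _ : ι => (1 : ℍ)), (1 : ℍ)) with hp₀
  have hcont := continuousAt_kD_one (ι := ι) c
  obtain ⟨δ₁, hδ₁, hδ₁'⟩ := (NormedAddCommGroup.tendsto_nhds_nhds (f := fun p : (ι → ℍ) × ℍ => kD p.1 c p.2) (x := p₀)
    (y := kD (fun _ : ι => (1 : ℍ)) c 1)).mp hcont _ hε
  obtain ⟨δ₂, hδ₂, hball⟩ := Metric.isOpen_iff.1 (isOpen_guardSet (ι := ι)) _ one_mem_guardSet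
  set ρ : ℝ := min δ₁ δ₂ / 4 with hρ_def
  have hρ : 0 < ρ := by positivity
  have hρ₁ : 2 * ρ < δ₁ := by
    have := min_le_left δ₁ δ₂; rw [hρ_def]; linarith
  have hρ₂ : 2 * ρ < δ₂ := by
    have := min_le_right δ₁ δ₂; rw [hρ_def]; linarith
  refine ⟨ρ, hρ, fun a ha => ?_⟩
  -- points of the ball are in the guard and have differential close to `D₀`
  have hmem : ∀ y : ℍ, ‖y - 1‖ ≤ 2 * ρ → ((a, y) : (ι → ℍ) × ℍ) ∈ guardSet ι := fun y hy =>
    hball ((dist_le_of_coords (by linarith) ha hy).trans_lt hρ₂)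
  have hclose : ∀ y : ℍ, ‖y - 1‖ ≤ 2 * ρ → ‖kD a c y - dZero s‖ ≤ (1 - s) / 2 := fun y hy => by
    have h : ‖((a, y) : (ι → ℍ) × ℍ) - p₀‖ < δ₁ := by
      rw [← dist_eq_norm]; exact (dist_le_of_coords (by linarith) ha hy).trans_lt hρ₁
    have h1 := hδ₁' ((a, y) : (ι → ℍ) × ℍ) h
    beta_reduce at h1
    have h' : ‖kD a c y - kD (fun _ : ι => (1 : ℍ)) c 1‖ < (1 - s) / 2 := h1
    rw [kD_one_one] at h'
    exact h'.le
  refine ⟨fun y hy => hmem y hy, ?_⟩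
  -- mean value inequality for `kf − D₀` on the convex ball
  have hconv : Convex ℝ (closedBall (1 : ℍ) (2 * ρ)) := convex_closedBall _ _
  have hderiv : ∀ y ∈ closedBall (1 : ℍ) (2 * ρ),
      HasFDerivWithinAt (fun z => kf a c z - dZero s z) (kD a c y - dZero s) (closedBall (1 : ℍ) (2 * ρ)) y := by
    intro y hy
    rw [mem_closedBall, dist_eq_norm] at hy
    exact ((hasStrictFDerivAt_kf c (hmem y hy)).hasFDerivAt.sub (dZero s).hasFDerivAt).hasFDerivWithinAt
  have hbound : ∀ y ∈ closedBall (1 : ℍ) (2 * ρ), ‖kD a c y - dZero s‖ ≤ (1 - s) / 2 := fun y hy => by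
    rw [mem_closedBall, dist_eq_norm] at hy
    exact hclose y hy
  intro x hx y hy
  have h := hconv.norm_image_sub_le_of_norm_hasFDerivWithin_le hderiv hbound hy hx
  have heq : kf a c x - kf a c y - dZero s (x - y) = (kf a c x - dZero s x) - (kf a c y - dZero s y) := by
    rw [map_sub]; abel
  rw [heq, Real.coe_toNNReal _ hε.le]
  exact h

/-- **A UNIFORM LOCAL INVERSE OF THE FIBRE MAP NEAR THE DEGENERATE POINT `(1, 1)`** (inverse function theorem with parameters):
for weights `c_i ≥ 0`, `s = Σ c_i < 1`, there is `ρ > 0` such that for all `a` with `‖a_i − 1‖ ≤ ρ`, all base points `u⋆` with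
`‖u⋆ − 1‖ ≤ ρ` and all targets `t` with `‖t − kf a c u⋆‖ ≤ (1 − s)ρ/2`, the equation `kf a c u = t` has a solution with
`‖u − u⋆‖ ≤ (2/(1 − s))·‖t − kf a c u⋆‖`. -/
theorem exists_kf_eq_near_one (c : ι → ℝ) (hc : ∀ i, 0 ≤ c i) (hs : ∑ i, c i < 1) :
    ∃ ρ : ℝ, 0 < ρ ∧ ∀ a : ι → ℍ, (∀ i, ‖a i - 1‖ ≤ ρ) → ∀ ustar : ℍ, ‖ustar - 1‖ ≤ ρ →
      ∀ t : ℍ, ‖t - kf a c ustar‖ ≤ (1 - ∑ i, c i) / 2 * ρ →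
        ∃ u : ℍ, kf a c u = t ∧ ‖u - ustar‖ ≤ 2 / (1 - ∑ i, c i) * ‖t - kf a c ustar‖ := by
  set s : ℝ := ∑ i, c i with hs_def
  have hs0 : 0 ≤ s := Finset.sum_nonneg fun i _ => hc i
  have hs1 : s ^ 2 ≠ 1 := by nlinarith
  have h1s : 0 < 1 - s := by linarith
  have hε : 0 ≤ (1 - s) / 2 := by linarith
  obtain ⟨ρ, hρ, hρ'⟩ := exists_approximatesLinearOn c hs
  refine ⟨ρ, hρ, fun a ha ustar hustar t ht => ?_⟩
  obtain ⟨-, happ⟩ := hρ' a fun i => (ha i).trans (by linarith)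
  set c₀ : ℝ≥0 := ((1 - s) / 2).toNNReal with hc₀_def
  have hc₀ : (c₀ : ℝ) = (1 - s) / 2 := Real.coe_toNNReal _ hε
  -- the model differential as an equivalence, with `‖D₀⁻¹‖ ≤ (1 − s)⁻¹`
  have happ' : ApproximatesLinearOn (kf a c) (dZeroEquiv hs1 : ℍ →L[ℝ] ℍ) (closedBall (1 : ℍ) (2 * ρ)) c₀ := happ
  set N : ℝ≥0 := ‖((dZeroEquiv hs1).symm : ℍ →L[ℝ] ℍ)‖₊ with hN_def
  have hN : (N : ℝ) ≤ (1 - s)⁻¹ := by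
    rw [hN_def, coe_nnnorm, coe_dZeroEquiv_symm]; exact norm_dZeroInv_le hs0 (by linarith)
  have hNpos : 0 < (N : ℝ) := by
    rw [hN_def, coe_nnnorm]; exact (dZeroEquiv hs1).norm_symm_pos
  have hNinv : 1 - s ≤ (N : ℝ)⁻¹ := by
    rw [le_inv_comm₀ h1s hNpos]
    exact hN
  have hc_lt : c₀ < N⁻¹ := by
    apply NNReal.coe_lt_coe.mp
    rw [NNReal.coe_inv, hc₀]
    linarith
  -- surjectivity onto a ball of radius `((N⁻¹ − c₀)·ρ) ≥ (1 − s)ρ/2` around `kf ustar`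
  have hsub : closedBall ustar ρ ⊆ closedBall (1 : ℍ) (2 * ρ) := by
    intro y hy
    rw [mem_closedBall, dist_eq_norm] at hy ⊢
    calc ‖y - 1‖ = ‖(y - ustar) + (ustar - 1)‖ := by rw [sub_add_sub_cancel]
      _ ≤ ‖y - ustar‖ + ‖ustar - 1‖ := norm_add_le _ _
      _ ≤ 2 * ρ := by linarith
  have hsurj := happ'.surjOn_closedBall_of_nonlinearRightInverse (dZeroEquiv hs1).toNonlinearRightInverse hρ.le hsub
  have hnn : (((dZeroEquiv hs1).toNonlinearRightInverse).nnnorm : ℝ) = N := rfl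
  set R : ℝ := ((((dZeroEquiv hs1).toNonlinearRightInverse).nnnorm : ℝ)⁻¹ - (c₀ : ℝ)) * ρ with hR_def
  have hrad : (1 - s) / 2 * ρ ≤ R := by
    rw [hR_def, hnn, hc₀]
    have : (1 - s) / 2 ≤ (N : ℝ)⁻¹ - (1 - s) / 2 := by linarith
    exact mul_le_mul_of_nonneg_right this hρ.le
  have ht' : t ∈ closedBall (kf a c ustar) R := by
    rw [mem_closedBall, dist_eq_norm]
    exact ht.trans hrad
  obtain ⟨u, hu, hut⟩ := hsurj ht'
  refine ⟨u, hut, ?_⟩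
  -- the Lipschitz bound from the antilipschitz property of the approximated map
  have hanti := happ'.antilipschitz (Or.inr hc_lt)
  have hK : ((N⁻¹ - c₀)⁻¹ : ℝ≥0) ≤ (2 / (1 - s)).toNNReal := by
    apply NNReal.coe_le_coe.mp
    have hpos : (0 : ℝ) < (N : ℝ)⁻¹ - (1 - s) / 2 := by linarith
    rw [NNReal.coe_inv, NNReal.coe_sub hc_lt.le, NNReal.coe_inv, hc₀, Real.coe_toNNReal _ (by positivity),
      inv_le_comm₀ hpos (by positivity), inv_div]
    linarith
  have hdist := hanti.le_mul_dist ⟨u, hsub hu⟩ ⟨ustar, hsub (mem_closedBall_self hρ.le)⟩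
  rw [Subtype.dist_eq, dist_eq_norm, dist_eq_norm] at hdist
  have hdist' : ‖u - ustar‖ ≤ ↑((N⁻¹ - c₀)⁻¹) * ‖kf a c u - kf a c ustar‖ := hdist
  rw [hut] at hdist'
  refine hdist'.trans (mul_le_mul_of_nonneg_right ?_ (norm_nonneg _))
  have := NNReal.coe_le_coe.mpr hK
  rwa [Real.coe_toNNReal _ (by positivity)] at this

end IFT

/-! ## §5 Transport to an arbitrary unit base point -/

section Transport

variable {ι : Type*} [Fintype ι]

/-- A unit quaternion satisfies `q̄ q = 1`. -/
theorem star_mul_self_of_norm_eq_one {q : ℍ} (hq : ‖q‖ = 1) : star q * q = 1 := by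
  rw [Quaternion.star_mul_self, Quaternion.normSq_eq_norm_mul_self, hq, mul_one, Quaternion.coe_one]

/-- A unit quaternion satisfies `q q̄ = 1`. -/
theorem self_mul_star_of_norm_eq_one {q : ℍ} (hq : ‖q‖ = 1) : q * star q = 1 := by
  rw [Quaternion.self_mul_star, Quaternion.normSq_eq_norm_mul_self, hq, mul_one, Quaternion.coe_one]

/-- **RIGHT TRANSLATION INTERTWINES THE FIBRE MAPS**: `kf (a q̄) c (u q̄) = (kf a c u) q̄` for a unit `q` (the exponent is
unchanged, `Yf_mul_star`). -/
theorem Yf_mul_star (a : ι → ℍ) (c : ι → ℝ) (u : ℍ) {q : ℍ} (hq : ‖q‖ = 1) :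
    Yf (fun i => a i * star q) c (u * star q) = Yf a c u := by
  unfold Yf
  refine Finset.sum_congr rfl fun i _ => ?_
  rw [star_mul, star_star, ← mul_assoc, mul_assoc (a i), star_mul_self_of_norm_eq_one hq, mul_one]

/-- `kf (a q̄) c (u q̄) = (kf a c u) q̄` for a unit `q`. -/
theorem kf_mul_star (a : ι → ℍ) (c : ι → ℝ) (u : ℍ) {q : ℍ} (hq : ‖q‖ = 1) :
    kf (fun i => a i * star q) c (u * star q) = kf a c u * star q := by
  rw [kf, kf, Yf_mul_star a c u hq, mul_assoc]

/-- **A UNIFORM LOCAL INVERSE OF THE FIBRE MAP NEAR THE DEGENERATE SET** `{a_i = u⋆}`: for weights `c_i ≥ 0`, `s = Σ c_i < 1`, there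
is `ρ > 0` (depending only on `ι`, `c`) such that for every UNIT base point `u⋆`, all parameters with `‖a_i − u⋆‖ ≤ ρ` and all
targets `t` with `‖t − kf a c u⋆‖ ≤ (1 − s)ρ/2`, the equation `kf a c u = t` has a solution within `(2/(1 − s))·‖t − kf a c u⋆‖`
of `u⋆`, lying in the guard `‖a_i ū − 1‖ < 1`. -/
theorem exists_kf_eq_near (c : ι → ℝ) (hc : ∀ i, 0 ≤ c i) (hs : ∑ i, c i < 1) :
    ∃ ρ : ℝ, 0 < ρ ∧ ∀ a : ι → ℍ, ∀ ustar : ℍ, ‖ustar‖ = 1 → (∀ i, ‖a i - ustar‖ ≤ ρ) →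
      ∀ t : ℍ, ‖t - kf a c ustar‖ ≤ (1 - ∑ i, c i) / 2 * ρ →
        ∃ u : ℍ, kf a c u = t ∧ ‖u - ustar‖ ≤ 2 / (1 - ∑ i, c i) * ‖t - kf a c ustar‖ ∧
          ∀ i, ‖a i * star u - 1‖ < 1 := by
  obtain ⟨ρ, hρ, happ⟩ := exists_approximatesLinearOn c hs
  obtain ⟨ρ', hρ', hsol⟩ := exists_kf_eq_near_one c hc hs
  -- we use the common radius `min ρ ρ'`; both statements are monotone in the radius
  refine ⟨min ρ ρ', lt_min hρ hρ', fun a ustar hu ha t ht => ?_⟩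
  have hmin₁ : min ρ ρ' ≤ ρ := min_le_left _ _
  have hmin₂ : min ρ ρ' ≤ ρ' := min_le_right _ _
  have h1s : 0 ≤ (1 - ∑ i, c i) / 2 := by linarith
  -- translate to the base point `1`
  set q : ℍ := ustar with hq_def
  set a' : ι → ℍ := fun i => a i * star q with ha'_def
  set t' : ℍ := t * star q with ht'_def
  have hqq : star q * q = 1 := star_mul_self_of_norm_eq_one hu
  have hqq' : q * star q = 1 := self_mul_star_of_norm_eq_one hu
  have hnq : ‖star q‖ = 1 := by rw [norm_star, hu]
  have ha' : ∀ i, ‖a' i - 1‖ ≤ min ρ ρ' := fun i => by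
    have : a' i - 1 = (a i - q) * star q := by rw [sub_mul, hqq']
    rw [this, norm_mul, hnq, mul_one]; exact ha i
  have hkf1 : kf a' c 1 = kf a c ustar * star q := by
    rw [← kf_mul_star a c ustar hu, hqq']
  have ht' : ‖t' - kf a' c 1‖ = ‖t - kf a c ustar‖ := by
    rw [hkf1, ht'_def, ← sub_mul, norm_mul, hnq, mul_one]
  have ht'le : ‖t' - kf a' c 1‖ ≤ (1 - ∑ i, c i) / 2 * ρ' := by
    rw [ht']; exact ht.trans (mul_le_mul_of_nonneg_left hmin₂ h1s)
  obtain ⟨u', hu't, hu'd⟩ := hsol a' (fun i => (ha' i).trans hmin₂) 1 (by simp [hρ'.le]) t' ht'le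
  refine ⟨u' * q, ?_, ?_, ?_⟩
  · -- `kf a c (u' q) = t`: translate back
    have h := kf_mul_star a c (u' * q) hu
    rw [mul_assoc, hqq', mul_one] at h
    -- `h : kf a' c u' = kf a c (u' * q) * star q`
    have h2 : kf a c (u' * q) * star q = t * star q := by rw [← h, hu't]
    calc kf a c (u' * q) = kf a c (u' * q) * star q * q := by rw [mul_assoc, hqq, mul_one]
      _ = t * star q * q := by rw [h2]
      _ = t := by rw [mul_assoc, hqq, mul_one]
  · have : u' * q - ustar = (u' - 1) * q := by rw [sub_mul, one_mul]
    rw [this, norm_mul, hu, mul_one, ← ht']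
    exact hu'd
  · -- the solution lies in the guard (it is within `2ρ` of the base point after translation)
    intro i
    have hg := (happ a' fun i => (ha' i).trans (hmin₁.trans (by linarith))).1
    have hu'1 : ‖u' - 1‖ ≤ 2 * ρ := by
      have hK : 2 / (1 - ∑ i, c i) * ‖t' - kf a' c 1‖ ≤ ρ := by
        have h1 : 0 < 1 - ∑ i, c i := by linarith
        calc 2 / (1 - ∑ i, c i) * ‖t' - kf a' c 1‖ ≤ 2 / (1 - ∑ i, c i) * ((1 - ∑ i, c i) / 2 * min ρ ρ') :=
              mul_le_mul_of_nonneg_left (by rw [ht']; exact ht) (by positivity)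
          _ = min ρ ρ' := by field_simp
          _ ≤ ρ := hmin₁
      linarith [hu'd.trans hK]
    have h3 := hg u' hu'1 i
    rw [star_mul, ← mul_assoc]
    exact h3

end Transport

/-! ## §6 Solutions with unit target are units -/

section Unit

variable {ι : Type*} [Fintype ι]

/-- Real part of a finite sum of quaternions. -/
theorem re_sum (f : ι → ℍ) : (∑ i, f i).re = ∑ i, (f i).re :=
  map_sum (QuaternionAlgebra.reₗ (R := ℝ) (-1) 0 (-1)) f Finset.univ

/-- The real part of the exponent: `re (Yf a c y) = s · log ‖y‖` for unit `a_i` in the guard. -/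
theorem Yf_re {a : ι → ℍ} (ha : ∀ i, ‖a i‖ = 1) (c : ι → ℝ) {y : ℍ} (hg : ∀ i, ‖a i * star y - 1‖ < 1) :
    (Yf a c y).re = (∑ i, c i) * Real.log ‖y‖ := by
  unfold Yf
  rw [re_sum, Finset.sum_mul]
  refine Finset.sum_congr rfl fun i _ => ?_
  rw [Quaternion.re_smul, qlog_re (hg i), norm_mul, ha i, one_mul, norm_star, smul_eq_mul]

/-- **THE NORM OF THE FIBRE MAP**: `‖kf a c y‖ = ‖y‖^{1+s}` for `y ≠ 0` (unit `a_i`, in the guard). -/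
theorem norm_kf {a : ι → ℍ} (ha : ∀ i, ‖a i‖ = 1) (c : ι → ℝ) {y : ℍ} (hy : y ≠ 0)
    (hg : ∀ i, ‖a i * star y - 1‖ < 1) : ‖kf a c y‖ = ‖y‖ ^ ((∑ i, c i) + 1) := by
  have hpos : 0 < ‖y‖ := norm_pos_iff.mpr hy
  rw [kf, norm_mul, Quaternion.norm_exp, ← congrFun Real.exp_eq_exp_ℝ (Yf a c y).re, Real.norm_eq_abs, Real.abs_exp,
    Yf_re ha c hg, Real.rpow_add_one hpos.ne', Real.rpow_def_of_pos hpos, mul_comm (Real.log ‖y‖)]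

/-- **A SOLUTION WITH A UNIT TARGET IS A UNIT**: if `kf a c y = t` with `‖t‖ = 1`, unit `a_i`, weights `c_i ≥ 0` and `y` in the
guard, then `‖y‖ = 1`. -/
theorem norm_eq_one_of_kf_eq {a : ι → ℍ} (ha : ∀ i, ‖a i‖ = 1) {c : ι → ℝ} (hc : ∀ i, 0 ≤ c i) {y t : ℍ}
    (hg : ∀ i, ‖a i * star y - 1‖ < 1) (hyt : kf a c y = t) (ht : ‖t‖ = 1) : ‖y‖ = 1 := by
  have hs : 0 ≤ ∑ i, c i := Finset.sum_nonneg fun i _ => hc i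
  by_cases hy : y = 0
  · exfalso
    rw [hy, kf, mul_zero] at hyt
    rw [← hyt, norm_zero] at ht
    exact zero_ne_one ht
  have h := norm_kf ha c hy hg
  rw [hyt, ht] at h
  -- `‖y‖^{1+s} = 1` with `1 + s > 0` forces `‖y‖ = 1`
  have hexp : 0 < (∑ i, c i) + 1 := by linarith
  rcases lt_trichotomy ‖y‖ 1 with hlt | heq | hgt
  · exfalso
    have := Real.rpow_lt_one (norm_nonneg y) hlt hexp
    rw [← h] at this
    exact lt_irrefl _ this
  · exact heq
  · exfalso
    have := Real.one_lt_rpow hgt hexp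
    rw [← h] at this
    exact lt_irrefl _ this

end Unit




end Summit.QuantumFields.YangMills.Theorems.FibreLocalInverse

end
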